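/-
Copyright (c) 2026 the pub-hodgecm-mathlib formalisation cell (harness21).  Prover seat hodgecm-mathlib-K2Liu-p14 (g2), Track B «K2-LIT»,
#184♮ = hLiu418 = `stmt-HodgeConjecture-24832`; Road Φ ∕ socket #41, organ G5-a (Φ7-2), face (β0) of LEAD F0P6-plan RULING «M-157b», consumption side
(LEAD BATCH #5 2026-09-04T11:40:22Z «(β0) consumption side, hypothesis-first: (β0-3)∕(β0-4) + (β0-1b) shape»; census K2Liu-p14 (g2) 11:42:27Z).
-/
import Summits.HodgeConjecture.HodgeConjecture.Theorems.K2LiuGL2FlatSectionsGodementExhaust   -- ★ (β): the letters `hT hN hbK hBK hlev hcont hfin` this file PRODUCES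
import Summits.HodgeConjecture.HodgeConjecture.Theorems.K2LiuMiddleCellGodementJunction      -- ★ junction (the (β0) face this file serves; brings ★ `exists_finsupp_eval_eq`)
import HarnessLib

/-!
# Crux `HLiu418`, Road Φ, organ G5-a, face (β0-3)+(β0-2): FLAT COORDINATES — a family of `GL₂(𝔸_L)`-sections `φ(s, x; ·)` with the flat Borel law, whose
# restrictions to `K` lie in ONE finite-dimensional space `W` and are pointwise holomorphic in `s`, IS `Σ_i λ_i(s, x) · b_i(s, ·)` for the FLAT `K`-finite
# standard sections `b_i` through a basis of `W`, with `λ_i` holomorphic and of the same growth as `φ` — the (β0) face of ★ junction + the inputs of ★ (β)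

Cell `hodgecm-mathlib`, crux item hLiu418 = `stmt-HodgeConjecture-24832`; squad K2 ∕ K2Liu; prover K2Liu-p14 (g2).  THEOREMS ONLY (no `def`, no instance, no
notation, no named-fact hypothesis, no `sorry`); lane `--supports stmt-HodgeConjecture-24832 --as helper`.

WHY (the (β0) face of ★ junction `K2LiuMiddleCellGodementJunction.middle_eq_sum_mirabolicEisenstein`: `hφ : φ s x g = Σ_i lam i s x · b i s g`, with `b i` in the currency
of ★ (β) `K2LiuGL2FlatSectionsGodementExhaust.exists_godement_exhaust_of_flat`).  In the instantiation `X = H(𝔸)`, `φ s h g = ξ_s(det g)⁻¹ξ_s(det a_h) F_s(Λ(g) k_h)` (inner section of the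
middle cell, ★ α3-2, read through the Iwasawa coordinates `h = n Λ(a_h) k_h` and untwisted by the central character (β0-1b) produces): its restriction to `K = K_{GL₂}` is a
combination of matrix coefficients of `K_H` on the finite-dimensional `K_H`-span of the `K_H`-finite flat section `f` — a FIXED finite-dimensional space `W` of functions on
`K`, independent of `s` and `h` — with coefficients holomorphic in `s`.  THIS FILE is the abstract step (every analytic∕geometric input BY VALUE, named):
given
* `W ≤ (K → ℂ)` finite-dimensional, right-`K`-stable (`hWstab`), with the `B ∩ K`-law (`hWlaw`), a level (`hWlev`), continuous members (`hWcont`), and FLAT EXTENSIONS of its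
  members to `GL₂(𝔸)` (`hWext`: the standard section through `B ∈ W` — (β0-ext), the `GL₂(𝔸)` Iwasawa bookkeeping, BY VALUE here);
* the family `φ : ℂ → X → GL₂(𝔸) → ℂ` with the flat torus law `hφT` (exponents `(s+½, −(s+½))`), unipotent invariance `hφN`, `φ(s, x)|_K ∈ W` (`hφW`), pointwise
  holomorphy on `K` (`hφhol`) and a local bound `‖φ s x k‖ ≤ C · height x ^ A` (`hφbd`);
it PRODUCES `I` (finite), `lam`, `b`, `B` with: the identity `φ s x g = Σ_i lam i s x · b i s g` on `0 < re s` (on `K` by coordinates — each coordinate functional of `W` is a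
FINITE SUM OF EVALUATIONS, ★ `Literature.NumberTheory.Automorphic.exists_finsupp_eval_eq` — and off `K` by Iwasawa ★ `exists_borel_mul_standardMaximalCompactGL` and the shared law), `had` (holomorphy of
`lam i · x`), `hag` (`‖lam i s x‖ ≤ C′ · height x ^ A`), and ★ (β)'s `hT hN hbK hBK hlev hcont hfin` for `(b, B)` LITERALLY.
References: [MoeglinWaldspurger1995, II.1.7, IV.1.9]; [CogdellAnalyticTheory2004, §2.3]; [Bump1997, §3.7 (flat sections, Iwasawa)].
HONEST LABEL.  Count-neutral helper: `HC_CM` is proved only modulo the 7 printed citations (2 remaining named inputs: hLiu418 = `stmt-HodgeConjecture-24832`,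
h413 = `stmt-HodgeConjecture-24833`) until rung 0 closes.
-/

set_option autoImplicit false
set_option linter.dupNamespace false -- the mandated namespace repeats `HodgeConjecture.HodgeConjecture`

noncomputable section

open MeasureTheory NumberField IsDedekindDomain Set Filter Topology
open scoped NNReal Matrix Classical
open Literature.NumberTheory.Automorphic
open Summit.HodgeConjecture.HodgeConjecture.Cruxes.HLiu418.K2LiuGL2GodementSectionsExhaustGlobal (exists_glDiagonal_mul_of_mem_standardParabolicGL)
open Summit.HodgeConjecture.HodgeConjecture.Cruxes.HLiu418.K2LiuGL2FlatSectionFiniteData (ofFinite_mem)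

namespace Summit.HodgeConjecture.HodgeConjecture.Cruxes.HLiu418.K2LiuMiddleInnerSectionFlatCoords

variable {L : Type} [Field L] [NumberField L]

/-- a finite sum of evaluations of a family that is holomorphic at each point is holomorphic. [folklore] -/
theorem differentiableOn_finsupp_sum_eval {κ : Type*} (c : κ →₀ ℂ) {U : Set ℂ} {ψ : ℂ → κ → ℂ} (hψ : ∀ k, DifferentiableOn ℂ (fun s => ψ s k) U) :
    DifferentiableOn ℂ (fun s => c.sum fun k a => a * ψ s k) U := by
  simp only [Finsupp.sum]
  exact DifferentiableOn.fun_sum fun k _ => (hψ k).const_mul _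

/-- a finite sum of evaluations is bounded by `(Σ ‖c‖) ·` the pointwise bound. [folklore] -/
theorem norm_finsupp_sum_eval_le {κ : Type*} (c : κ →₀ ℂ) {ψ : κ → ℂ} {D : ℝ} (hψ : ∀ k, ‖ψ k‖ ≤ D) :
    ‖c.sum fun k a => a * ψ k‖ ≤ (∑ k ∈ c.support, ‖c k‖) * D := by
  simp only [Finsupp.sum]
  calc ‖∑ k ∈ c.support, c k * ψ k‖ ≤ ∑ k ∈ c.support, ‖c k‖ * D := by
        refine (norm_sum_le _ _).trans (Finset.sum_le_sum fun k _ => ?_)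
        rw [norm_mul]
        exact mul_le_mul_of_nonneg_left (hψ k) (norm_nonneg _)
    _ = (∑ k ∈ c.support, ‖c k‖) * D := (Finset.sum_mul _ _ _).symm

/-- **(β0-3)+(β0-2): FLAT COORDINATES.**  See the module docstring: from the finite-dimensional `K`-space `W` (right-stable, with the `B ∩ K`-law, a level, continuity and
flat extensions of its members) and the family `φ` (flat torus law, unipotent invariance, `φ(s,x)|_K ∈ W`, pointwise holomorphy, local bound) we get finitely many FLAT
`K`-FINITE STANDARD SECTIONS `b i` (with their `K`-types `B i`) satisfying ★ (β)'s `hT hN hbK hBK hlev hcont hfin`, and coefficients `lam i s x`, holomorphic on `{0 < re}` with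
`‖lam i s x‖ ≤ C′ · height x ^ A` locally in `s`, such that `φ s x g = Σ_i lam i s x · b i s g` for all `g ∈ GL₂(𝔸_L)`, `0 < re s`.
[cite: MoeglinWaldspurger1995, II.1.7, IV.1.9] [cite: Bump1997, §3.7] -/
theorem exists_flat_coords (S : Finset (HeightOneSpectrum (𝓞 L)))
    (γ : ∀ v : HeightOneSpectrum (𝓞 L), ValuativeRel.ValueGroupWithZero (v.adicCompletion L))
    {X : Type*} (height : X → ℝ)
    (W : Submodule ℂ (↥(standardMaximalCompactGL 2 L) → ℂ)) [FiniteDimensional ℂ W]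
    (hWstab : ∀ B ∈ W, ∀ k₀ : ↥(standardMaximalCompactGL 2 L), (fun k => B (k * k₀)) ∈ W)
    (hWlaw : ∀ B ∈ W, ∀ p k : ↥(standardMaximalCompactGL 2 L),
      ((p : GL (Fin 2) (AdeleRing (𝓞 L) L)) : Matrix (Fin 2) (Fin 2) (AdeleRing (𝓞 L) L)) 1 0 = 0 → B (p * k) = B k)
    (hWlev : ∀ B ∈ W, ∀ (k : ↥(standardMaximalCompactGL 2 L)) (r : GL (Fin 2) (FiniteAdeleRing (𝓞 L) L)) (hr : r ∈ glFiniteIntegralLevel 2 L),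
      (∀ v ∈ S, GLn.evalAt 2 L v r ∈ congruenceGL 2 (γ v)) →
        B ⟨(k : GL (Fin 2) (AdeleRing (𝓞 L) L)) * GLn.ofFinite 2 L r, (standardMaximalCompactGL 2 L).mul_mem k.2 (ofFinite_mem hr)⟩ = B k)
    (hWcont : ∀ B ∈ W, Continuous B)
    (hWext : ∀ B ∈ W, ∃ bB : ℂ → GL (Fin 2) (AdeleRing (𝓞 L) L) → ℂ,
      (∀ s : ℂ, 0 < s.re → ∀ (d : Fin 2 → (AdeleRing (𝓞 L) L)ˣ) (g : GL (Fin 2) (AdeleRing (𝓞 L) L)),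
        bB s (glDiagonal 2 (AdeleRing (𝓞 L) L) d * g) =
          ((IdeleClassGroup.ideleNorm L (d 0) : ℝ) : ℂ) ^ (s + 1 / 2) * ((IdeleClassGroup.ideleNorm L (d 1) : ℝ) : ℂ) ^ (-(s + 1 / 2)) * bB s g) ∧
      (∀ s : ℂ, 0 < s.re → ∀ u g : GL (Fin 2) (AdeleRing (𝓞 L) L), (u : Matrix (Fin 2) (Fin 2) (AdeleRing (𝓞 L) L)) 1 0 = 0 →
        (u : Matrix (Fin 2) (Fin 2) (AdeleRing (𝓞 L) L)) 0 0 = 1 → (u : Matrix (Fin 2) (Fin 2) (AdeleRing (𝓞 L) L)) 1 1 = 1 → bB s (u * g) = bB s g) ∧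
      (∀ s : ℂ, 0 < s.re → ∀ (k : GL (Fin 2) (AdeleRing (𝓞 L) L)) (hk : k ∈ standardMaximalCompactGL 2 L), bB s k = B ⟨k, hk⟩))
    (φ : ℂ → X → GL (Fin 2) (AdeleRing (𝓞 L) L) → ℂ)
    (hφT : ∀ (s : ℂ) (x : X), 0 < s.re → ∀ (d : Fin 2 → (AdeleRing (𝓞 L) L)ˣ) (g : GL (Fin 2) (AdeleRing (𝓞 L) L)),
      φ s x (glDiagonal 2 (AdeleRing (𝓞 L) L) d * g) =
        ((IdeleClassGroup.ideleNorm L (d 0) : ℝ) : ℂ) ^ (s + 1 / 2) * ((IdeleClassGroup.ideleNorm L (d 1) : ℝ) : ℂ) ^ (-(s + 1 / 2)) * φ s x g)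
    (hφN : ∀ (s : ℂ) (x : X), 0 < s.re → ∀ u g : GL (Fin 2) (AdeleRing (𝓞 L) L), (u : Matrix (Fin 2) (Fin 2) (AdeleRing (𝓞 L) L)) 1 0 = 0 →
      (u : Matrix (Fin 2) (Fin 2) (AdeleRing (𝓞 L) L)) 0 0 = 1 → (u : Matrix (Fin 2) (Fin 2) (AdeleRing (𝓞 L) L)) 1 1 = 1 → φ s x (u * g) = φ s x g)
    (hφW : ∀ (s : ℂ) (x : X), 0 < s.re → (fun k : ↥(standardMaximalCompactGL 2 L) => φ s x k) ∈ W)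
    (hφhol : ∀ (x : X) (k : ↥(standardMaximalCompactGL 2 L)), DifferentiableOn ℂ (fun s => φ s x k) {s : ℂ | 0 < s.re})
    (hφbd : ∀ z : ℂ, 0 < z.re → ∃ C A r : ℝ, 0 ≤ C ∧ 0 ≤ A ∧ 0 < r ∧ ∀ s : ℂ, dist s z < r →
      ∀ (x : X) (k : ↥(standardMaximalCompactGL 2 L)), ‖φ s x k‖ ≤ C * height x ^ A) :
    ∃ (I : Type) (_ : Fintype I) (lam : I → ℂ → X → ℂ) (b : I → ℂ → GL (Fin 2) (AdeleRing (𝓞 L) L) → ℂ) (B : I → GL (Fin 2) (AdeleRing (𝓞 L) L) → ℂ),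
      (∀ (s : ℂ) (x : X) (g : GL (Fin 2) (AdeleRing (𝓞 L) L)), 0 < s.re → φ s x g = ∑ i, lam i s x * b i s g) ∧
      (∀ i x, DifferentiableOn ℂ (fun s => lam i s x) {s : ℂ | 0 < s.re}) ∧
      (∀ z : ℂ, 0 < z.re → ∃ C A r : ℝ, 0 ≤ C ∧ 0 ≤ A ∧ 0 < r ∧ ∀ s : ℂ, dist s z < r → ∀ i x, ‖lam i s x‖ ≤ C * height x ^ A) ∧
      (∀ (i : I) (s : ℂ), 0 < s.re → ∀ (d : Fin 2 → (AdeleRing (𝓞 L) L)ˣ) (g : GL (Fin 2) (AdeleRing (𝓞 L) L)),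
        b i s (glDiagonal 2 (AdeleRing (𝓞 L) L) d * g) =
          ((IdeleClassGroup.ideleNorm L (d 0) : ℝ) : ℂ) ^ (s + 1 / 2) * ((IdeleClassGroup.ideleNorm L (d 1) : ℝ) : ℂ) ^ (-(s + 1 / 2)) * b i s g) ∧
      (∀ (i : I) (s : ℂ), 0 < s.re → ∀ (u g : GL (Fin 2) (AdeleRing (𝓞 L) L)), (u : Matrix (Fin 2) (Fin 2) (AdeleRing (𝓞 L) L)) 1 0 = 0 →
        (u : Matrix (Fin 2) (Fin 2) (AdeleRing (𝓞 L) L)) 0 0 = 1 → (u : Matrix (Fin 2) (Fin 2) (AdeleRing (𝓞 L) L)) 1 1 = 1 → b i s (u * g) = b i s g) ∧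
      (∀ (i : I) (s : ℂ), 0 < s.re → ∀ k ∈ standardMaximalCompactGL 2 L, b i s k = B i k) ∧
      (∀ (i : I), ∀ p ∈ standardMaximalCompactGL 2 L, ∀ k ∈ standardMaximalCompactGL 2 L,
        (p : Matrix (Fin 2) (Fin 2) (AdeleRing (𝓞 L) L)) 1 0 = 0 → B i (p * k) = B i k) ∧
      (∀ (i : I), ∀ k ∈ standardMaximalCompactGL 2 L, ∀ r ∈ glFiniteIntegralLevel 2 L, (∀ v ∈ S, GLn.evalAt 2 L v r ∈ congruenceGL 2 (γ v)) →
        B i (k * GLn.ofFinite 2 L r) = B i k) ∧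
      (∀ i, Continuous fun k : ↥(standardMaximalCompactGL 2 L) => B i k) ∧
      (∀ i, FiniteDimensional ℂ (Submodule.span ℂ (Set.range fun k₀ : ↥(standardMaximalCompactGL 2 L) =>
        fun k : ↥(standardMaximalCompactGL 2 L) => B i ((k : GL (Fin 2) (AdeleRing (𝓞 L) L)) * k₀)))) := by
  -- a basis of `W`; coordinate functionals as finite sums of evaluations (★ junction §1)
  set d : ℕ := Module.finrank ℂ W with hd
  let bW : Module.Basis (Fin d) ℂ W := Module.finBasis ℂ W
  choose c hc using fun i : Fin d => Literature.NumberTheory.Automorphic.exists_finsupp_eval_eq W (bW.coord i)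
  -- flat extensions of the basis functions
  choose bext hbT hbN hbK using fun i : Fin d => hWext (bW i : ↥(standardMaximalCompactGL 2 L) → ℂ) (bW i).2
  -- the data
  refine ⟨Fin d, inferInstance, fun i s x => (c i).sum fun k a => a * φ s x k, bext,
    fun i g => if hg : g ∈ standardMaximalCompactGL 2 L then (bW i : ↥(standardMaximalCompactGL 2 L) → ℂ) ⟨g, hg⟩ else 0,
    ?_, ?_, ?_, hbT, hbN, ?_, ?_, ?_, ?_, ?_⟩
  · -- the identity: on `K` by coordinates, off `K` by Iwasawa and the shared flat law
    intro s x g hs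
    have hK : ∀ (k : GL (Fin 2) (AdeleRing (𝓞 L) L)) (hk : k ∈ standardMaximalCompactGL 2 L),
        φ s x k = ∑ i, ((c i).sum fun k' a => a * φ s x k') * bext i s k := by
      intro k hk
      have hrepr := bW.sum_repr ⟨fun k' : ↥(standardMaximalCompactGL 2 L) => φ s x k', hφW s x hs⟩
      have hcoe := congrArg (fun w : W => (w : ↥(standardMaximalCompactGL 2 L) → ℂ) ⟨k, hk⟩) hrepr
      simp only [Submodule.coe_sum, Submodule.coe_smul, Finset.sum_apply, Pi.smul_apply, smul_eq_mul] at hcoe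
      rw [← hcoe]
      refine Finset.sum_congr rfl fun i _ => ?_
      rw [hbK i s hs k hk, ← Module.Basis.coord_apply, hc i]
    obtain ⟨p, hp, k, hk, rfl⟩ := exists_borel_mul_standardMaximalCompactGL g
    obtain ⟨dd, u, hu10, hu00, hu11, -, -, rfl⟩ := exists_glDiagonal_mul_of_mem_standardParabolicGL hp
    rw [mul_assoc (glDiagonal 2 (AdeleRing (𝓞 L) L) dd) u k, hφT s x hs dd (u * k), hφN s x hs u k hu10 hu00 hu11, hK k hk, Finset.mul_sum]
    refine Finset.sum_congr rfl fun i _ => ?_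
    rw [hbT i s hs dd (u * k), hbN i s hs u k hu10 hu00 hu11]
    ring
  · -- `had`
    intro i x
    exact differentiableOn_finsupp_sum_eval (c i) fun k => hφhol x k
  · -- `hag`
    intro z hz
    obtain ⟨C, A, r, hC, hA, hr, hb⟩ := hφbd z hz
    refine ⟨(∑ i, ∑ k ∈ (c i).support, ‖c i k‖) * C, A, r, by positivity, hA, hr, fun s hs i x => ?_⟩
    have h1 := norm_finsupp_sum_eval_le (c i) (ψ := fun k => φ s x k) (fun k => hb s hs x k)
    refine h1.trans ?_
    rw [mul_assoc]
    refine mul_le_mul_of_nonneg_right (Finset.single_le_sum (f := fun i => ∑ k ∈ (c i).support, ‖c i k‖)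
      (fun i _ => Finset.sum_nonneg fun k _ => norm_nonneg _) (Finset.mem_univ i)) ?_
    exact le_trans (norm_nonneg _) (hb s hs x 1)
  · -- `hbK`
    intro i s hs k hk
    dsimp only
    rw [hbK i s hs k hk, dif_pos hk]
  · -- `hBK`
    intro i p hp k hk hp10
    dsimp only
    rw [dif_pos ((standardMaximalCompactGL 2 L).mul_mem hp hk), dif_pos hk]
    exact hWlaw _ (bW i).2 ⟨p, hp⟩ ⟨k, hk⟩ hp10
  · -- `hlev`
    intro i k hk r hr hrS
    dsimp only
    rw [dif_pos ((standardMaximalCompactGL 2 L).mul_mem hk (ofFinite_mem hr)), dif_pos hk]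
    exact hWlev _ (bW i).2 ⟨k, hk⟩ r hr hrS
  · -- `hcont`
    intro i
    dsimp only
    have h : (fun k : ↥(standardMaximalCompactGL 2 L) =>
        (if hg : (k : GL (Fin 2) (AdeleRing (𝓞 L) L)) ∈ standardMaximalCompactGL 2 L then
          (bW i : ↥(standardMaximalCompactGL 2 L) → ℂ) ⟨k, hg⟩ else 0)) = (bW i : ↥(standardMaximalCompactGL 2 L) → ℂ) := by
      funext k
      rw [dif_pos k.2]
    rw [h]
    exact hWcont _ (bW i).2
  · -- `hfin`
    intro i
    refine Submodule.finiteDimensional_of_le (S₂ := W) (Submodule.span_le.2 ?_)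
    rintro _ ⟨k₀, rfl⟩
    have h : (fun k : ↥(standardMaximalCompactGL 2 L) =>
        (if hg : ((k : GL (Fin 2) (AdeleRing (𝓞 L) L)) * k₀) ∈ standardMaximalCompactGL 2 L then
          (bW i : ↥(standardMaximalCompactGL 2 L) → ℂ) ⟨(k : GL (Fin 2) (AdeleRing (𝓞 L) L)) * k₀, hg⟩ else 0)) =
        fun k => (bW i : ↥(standardMaximalCompactGL 2 L) → ℂ) (k * k₀) := by
      funext k
      rw [dif_pos ((standardMaximalCompactGL 2 L).mul_mem k.2 k₀.2)]
      rfl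
    dsimp only
    rw [SetLike.mem_coe, h]
    exact hWstab _ (bW i).2 k₀

end Summit.HodgeConjecture.HodgeConjecture.Cruxes.HLiu418.K2LiuMiddleInnerSectionFlatCoords

end
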